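import Summits.CriticalPhenomena.PercolationContinuityZ3.Theorems.PercNearOneGluingNoHeavyPcintBSMKernel
import HarnessLib

/-!
# PCINT lane, PHASE 5 (block-renewal second moment): tail bounds from kernel checks

Cell `prim-pcint`, seat `prim-pcint-1` (gen 14); memo `run/shared/lean/prim/pcint/T-FIBRE-ROUTE.md` §PHASE 5.

Dischargers of the tail hypothesis `BSM.TailBound` of `BSM.criticalProb_le_of_checks` from decidable `ℚ` checks:
the rational tail `Ctail k s / N` (**`BSM.tailBound_of_ctailQ`**) and, for `k ≥ 5` time axes and `N = q₀ k`, the much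
smaller OSM tail `F(2N)(0)³ · k B(k,q₀)(q₀+1)²/q₀` of the oriented meeting series (**`BSM.tailBound_of_osmQ`**, with
`F(2N)(0)` bounded by the fixed-point row `BSM.frowU`).
-/

noncomputable section

namespace Summit.CriticalPhenomena.PercolationContinuityZ3.Theorems.Pcint.BSM

open Finset OSM

variable {t k : ℕ}

/-! ### Tail bounds from kernel checks -/

/-- The rational tail `Ctail/N` from a `ℚ` inequality. -/
theorem tailBound_of_ctailQ (hk : 2 ≤ k) (ht : 3 ≤ t) {a b : ℕ} (ha : 0 < a) (hab : a ≤ b) {N : ℕ} (hN : 1 ≤ N)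
    {Tn DG : ℕ} (h : CtailQ k ((a : ℚ) / b) / N ≤ (Tn : ℚ) / DG) :
    TailBound t k ((a : ℝ) / b) N ((Tn : ℝ) / DG) := by
  have hb : (0 : ℝ) < b := by exact_mod_cast lt_of_lt_of_le ha hab
  have h' := (Rat.cast_le (K := ℝ)).2 h
  push_cast at h'
  rw [CtailQ_cast] at h'
  push_cast at h'
  exact tailBound_ctail hk ht (by positivity) (by rw [div_le_one hb]; exact_mod_cast hab) hN h'

/-- The OSM tail over `ℚ`: `k · (q₀k)! / (q₀!^k k^{q₀k}) · (q₀+1)²/q₀`. -/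
def TailUQ (k q₀ : ℕ) : ℚ :=
  (k : ℚ) * ((Nat.factorial (q₀ * k) : ℕ) : ℚ) / ((((Nat.factorial q₀) ^ k : ℕ) : ℚ) * (((k ^ (q₀ * k)) : ℕ) : ℚ)) *
    ((q₀ : ℚ) + 1) ^ 2 / q₀

/-- `TailUQ` casts to `TailU`. -/
theorem TailUQ_cast (k q₀ : ℕ) : ((TailUQ k q₀ : ℚ) : ℝ) = TailU k q₀ := by
  unfold TailUQ TailU OSM.B
  push_cast
  ring

/-- **The OSM tail from a kernel check** (`k ≥ 5`, `N = q₀ k`): with `F0 = (frowU a b D (2N))[2N] ≥ F(2N)(0) · D`,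
the check `F0³ · TailUQ · DG ≤ Tn · D³` gives the tail bound `Tn/DG`. -/
theorem tailBound_of_osmQ (hk : 5 ≤ k) (ht : 3 ≤ t) {a b : ℕ} (ha : 0 < a) (hab : a ≤ b) {q₀ N : ℕ} (hq₀ : 1 ≤ q₀)
    (hN : N = q₀ * k) {D : ℕ} (hD : 0 < D) {Tn DG : ℕ} (hDG : 0 < DG)
    (h : (((frowU a b D (2 * N)).getD (2 * N) 0 : ℕ) : ℚ) ^ 3 * TailUQ k q₀ * DG ≤ (Tn : ℚ) * (D : ℚ) ^ 3) :
    TailBound t k ((a : ℝ) / b) N ((Tn : ℝ) / DG) := by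
  have hb0 : 0 < b := lt_of_lt_of_le ha hab
  have hb : (0 : ℝ) < b := by exact_mod_cast hb0
  have hs0 : (0 : ℝ) < (a : ℝ) / b := by positivity
  have hs1 : (a : ℝ) / b ≤ 1 := by rw [div_le_one hb]; exact_mod_cast hab
  have hDR : (0 : ℝ) < D := by exact_mod_cast hD
  have hDGR : (0 : ℝ) < DG := by exact_mod_cast hDG
  refine tailBound_osm hk ht hs0 hs1 hq₀ hN ?_
  -- `F(2N)(0) ≤ F0 / D`
  have hF := frowU_getD (by omega : a ≤ 2 * b) hb0 D (2 * N) (2 * N)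
  rw [show ((2 * N : ℕ) : ℤ) - (2 * N : ℕ) = 0 by simp] at hF
  set F0 : ℝ := (((frowU a b D (2 * N)).getD (2 * N) 0 : ℕ) : ℝ)
  have hF' : F ((a : ℝ) / b) (2 * N) 0 ≤ F0 / D := by rw [le_div_iff₀ hDR]; exact hF
  have hTU : 0 ≤ TailU k q₀ := by
    unfold TailU; have := OSM.B_pos (by omega : 0 < k) q₀; positivity
  have h' := (Rat.cast_le (K := ℝ)).2 h
  push_cast at h'
  rw [TailUQ_cast] at h'
  have hF0 : 0 ≤ F ((a : ℝ) / b) (2 * N) 0 := F_nonneg hs0.le hs1 _ _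
  calc F ((a : ℝ) / b) (2 * N) 0 ^ 3 * TailU k q₀ ≤ (F0 / D) ^ 3 * TailU k q₀ :=
        mul_le_mul_of_nonneg_right (pow_le_pow_left₀ hF0 hF' 3) hTU
    _ = F0 ^ 3 * TailU k q₀ * DG / (DG * D ^ 3) := by field_simp
    _ ≤ (Tn : ℝ) * (D : ℝ) ^ 3 / (DG * D ^ 3) := div_le_div_of_nonneg_right h' (by positivity)
    _ = (Tn : ℝ) / DG := by field_simp

end Summit.CriticalPhenomena.PercolationContinuityZ3.Theorems.Pcint.BSM

end
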